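import Mathlib

/-!
# Hodge-locus census, V3-XT N = 1 — ENGINE B: the Gross lattices of the unit tower `ℤ[i] + 7^k·O` for ALL `k` (Lemma 1 of the D7I countersign)

certified instances and evidence bearing on the general Hodge conjecture; no claim.

Both engines of the cell use, for the 7-inert row of the census, the by-hand lemma

  `S(ℤ[i] + 7^k·O) = {u·i + 7^k (y·j + z·k) : u, y, z ∈ ℤ, u ≡ z (mod 2)}`,  `nrd = u² + 7^(2k+1)(y² + z²)`,

where `B = (-1,-7)_ℚ` with basis `1, i, j, k` (`i² = -1`, `j² = -7`, `k = ij`), `O = ℤ⟨1, i, (1+j)/2, (i+k)/2⟩`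
is the maximal order used throughout the ROW 7 records, and for an order `R` the GROSS LATTICE is
`S(R) = {x ∈ ℤ + 2R : trd x = 0}`.  Engine A and engine B each machine-checked it for `k ≤ 3` (exact HNF);
`HodgeLocusCensusInert7BCore` records the Gram matrices.  This file proves the lemma for EVERY `k`, on
ℚ-coordinate vectors with respect to `1, i, j, k` (membership predicates only; no quaternion multiplication
is needed for the statement), together with the reduced-norm formula on `S`.

* `O`          : the set of coordinate vectors of the elements of `O`;
* `R k`        : … of `ℤ[i] + 7^k·O` (as the set `{α + 7^k β : α ∈ ℤ[i], β ∈ O}`);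
* `S k`        : the `s : Fin 3 → ℚ` (coordinates w.r.t. `i, j, k`) that are the pure part of some `x = n + 2v`,
                 `n ∈ ℤ`, `v ∈ ℤ[i] + 7^k·O`, with `trd x = 2(n + 2 v₀) = 0`;
* `mem_S_iff`  : `s ∈ S k ↔ ∃ u y z : ℤ, u ≡ z (mod 2) ∧ s = (u, 7^k y, 7^k z)`  — Lemma 1, all `k`;
* `nrd_pure`   : `nrd (0, u, 7^k y, 7^k z) = u² + 7^(2k+1) (y² + z²)`.
-/

set_option linter.dupNamespace false

namespace Summit.HodgeConjecture.HodgeConjecture.HodgeLocus.Census.Inert7BTower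

/-- The set of coordinate vectors `(t, x, y, z)` (w.r.t. `1, i, j, k`) of the elements of `O = ℤ⟨1, i, (1+j)/2, (i+k)/2⟩`. -/
def O : Set (Fin 4 → ℚ) :=
  {v | ∃ a b c d : ℤ, v = ![(a : ℚ) + c / 2, (b : ℚ) + d / 2, (c : ℚ) / 2, (d : ℚ) / 2]}

/-- Coordinate vectors of the order `ℤ[i] + 7^k·O = {α + 7^k β : α ∈ ℤ[i], β ∈ O}`. -/
def R (k : ℕ) : Set (Fin 4 → ℚ) :=
  {v | ∃ (a b : ℤ) (w : Fin 4 → ℚ), w ∈ O ∧ v = ![(a : ℚ), (b : ℚ), 0, 0] + (7 : ℚ) ^ k • w}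

/-- The Gross lattice `S(ℤ[i] + 7^k·O)` in coordinates w.r.t. `i, j, k`: the pure parts `(s₁, s₂, s₃)` of the
elements `x = n + 2v ∈ ℤ + 2(ℤ[i] + 7^k·O)` of reduced trace `2(n + 2v₀) = 0`. -/
def S (k : ℕ) : Set (Fin 3 → ℚ) :=
  {s | ∃ (n : ℤ) (v : Fin 4 → ℚ), v ∈ R k ∧ (n : ℚ) + 2 * v 0 = 0 ∧ s = ![2 * v 1, 2 * v 2, 2 * v 3]}

/-- `7^k - 1` is even. -/
theorem even_seven_pow_sub_one (k : ℕ) : Even ((7 : ℤ) ^ k - 1) := by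
  have h7 : Odd ((7 : ℤ) ^ k) := Odd.pow (by decide)
  exact Odd.sub_odd h7 odd_one

/-- LEMMA 1 (all `k`): `S(ℤ[i] + 7^k·O) = {u·i + 7^k(y·j + z·k) : u ≡ z (mod 2)}`. -/
theorem mem_S_iff (k : ℕ) (s : Fin 3 → ℚ) :
    s ∈ S k ↔ ∃ u y z : ℤ, Even (u - z) ∧ s = ![(u : ℚ), (7 : ℚ) ^ k * y, (7 : ℚ) ^ k * z] := by
  simp only [S, R, O, Set.mem_setOf_eq]
  constructor
  · rintro ⟨n, v, ⟨a, b, w, ⟨a', b', c', d', hw⟩, hv⟩, htr, hs⟩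
    subst hw; subst hv; subst hs
    refine ⟨2 * (b + 7 ^ k * b') + 7 ^ k * d', c', d', ?_, ?_⟩
    · have h1 : Even (((7 : ℤ) ^ k - 1) * d') := (even_seven_pow_sub_one k).mul_right d'
      have h2 : Even (2 * (b + 7 ^ k * b')) := even_two_mul _
      have : 2 * (b + 7 ^ k * b') + 7 ^ k * d' - d' = 2 * (b + 7 ^ k * b') + ((7 : ℤ) ^ k - 1) * d' := by ring
      rw [this]; exact h2.add h1
    · ext i; fin_cases i <;> simp <;> ring
  · rintro ⟨u, y, z, huz, hs⟩
    subst hs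
    have h1 : Even (((7 : ℤ) ^ k - 1) * z) := (even_seven_pow_sub_one k).mul_right z
    have h2 : Even (u - 7 ^ k * z) := by
      have : u - 7 ^ k * z = (u - z) - ((7 : ℤ) ^ k - 1) * z := by ring
      rw [this]; exact huz.sub h1
    obtain ⟨t, ht⟩ := h2
    -- u = 2t + 7^k z; take α = 0 + t·i ∈ ℤ[i], β = y(1+j)/2 + z(i+k)/2 ∈ O, n = -7^k y.
    refine ⟨-(7 ^ k * y), ![(7 : ℚ) ^ k * (y / 2), (t : ℚ) + (7 : ℚ) ^ k * (z / 2), (7 : ℚ) ^ k * (y / 2), (7 : ℚ) ^ k * (z / 2)], ?_, ?_, ?_⟩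
    · refine ⟨0, t, ![(y : ℚ) / 2, (z : ℚ) / 2, (y : ℚ) / 2, (z : ℚ) / 2], ⟨0, 0, y, z, ?_⟩, ?_⟩
      · ext i; fin_cases i <;> simp
      · ext i; fin_cases i <;> simp
    · simp; ring
    · have hu : (u : ℚ) = 2 * t + (7 : ℚ) ^ k * z := by
        have : u = t + t + 7 ^ k * z := by linarith
        rw [this]; push_cast; ring
      ext i; fin_cases i <;> simp [hu] <;> ring

/-- Reduced norm of `B = (-1,-7)_ℚ` in coordinates: `nrd (t + x i + y j + z k) = t² + x² + 7y² + 7z²`. -/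
def nrd (v : Fin 4 → ℚ) : ℚ := v 0 ^ 2 + v 1 ^ 2 + 7 * v 2 ^ 2 + 7 * v 3 ^ 2

/-- On the Gross lattice the reduced norm is the hand form `u² + 7^(2k+1)(y² + z²)`. -/
theorem nrd_pure (k : ℕ) (u y z : ℚ) :
    nrd ![0, u, (7 : ℚ) ^ k * y, (7 : ℚ) ^ k * z] = u ^ 2 + (7 : ℚ) ^ (2 * k + 1) * (y ^ 2 + z ^ 2) := by
  simp [nrd]; ring

/-- Consistency with the Gram matrices of `HodgeLocusCensusInert7BCore` (`G k` on the basis `2i, 7^k j, i + 7^k k`,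
even convention `G = (nrd(eₐ + e_b) - nrd eₐ - nrd e_b)`): the three basis vectors satisfy the parity condition and
have norms `4, 7^(2k+1), 1 + 7^(2k+1)`, i.e. half the diagonal `8, 2·7^(2k+1), 2 + 2·7^(2k+1)` of `G k`. -/
theorem basis_norms (k : ℕ) :
    nrd ![0, 2, 0, 0] = 4 ∧ nrd ![0, 0, (7 : ℚ) ^ k * 1, 0] = (7 : ℚ) ^ (2 * k + 1) ∧
    nrd ![0, 1, 0, (7 : ℚ) ^ k * 1] = 1 + (7 : ℚ) ^ (2 * k + 1) := by
  refine ⟨?_, ?_, ?_⟩ <;> simp [nrd] <;> ring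

end Summit.HodgeConjecture.HodgeConjecture.HodgeLocus.Census.Inert7BTower
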